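/-
Copyright: fleet lead `ym-wcr-19456-p1` (seat prover-ym-wcr-19456-p1-g0-0), route `WeakCouplingRates`, crux
`ColdBoxTwoPointFloor` (stmt-QuantumFields-19456), stub S3a `stub_boxGaussianWick`.
-/
import Summits.QuantumFields.YangMills.Theorems.WeakCouplingRatesDefs
import Literature.Probability.Distributions.MultivariateGaussianWick

/-!
# Crux `ColdBoxTwoPointFloor`, stub S3a `stub_boxGaussianWick`: Wick's theorem for the squared plaquette
# circulations of the comb-gauge lattice Maxwell Gaussian of the cold box, and the structure of D1

Stub S3a of the (lead-reshaped, registered 2026-08-26) birth skeleton of the crux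
`Summit.QuantumFields.YangMills.Theses.WeakCouplingRates.ColdBoxTwoPointFloor` — the pure-Gaussian half of the
Gaussian floor S3 `stub_boxGaussianFloor` (S3 ⇐ S3a ∧ S3c, `c₀ = 1`):

* `stub_boxGaussianWick` — for all `H, T`:  `boxCircSqCov H T = 2 · boxMaxwellPlaqCov H T ²`, i.e.
  `Cov_τ(s(p_c)², s(p_c + T e₀)²) = 2 · E_τ[s(p_c) s(p_c + T e₀)]²` under `τ = boxMaxwell H`
  (Isserlis 1918 / Wick: `E[X²Y²] = E[X²]E[Y²] + 2E[XY]²` for a centred Gaussian pair).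

On the way, the structure of the posited object D1 (`Theorems/WeakCouplingRatesDefs.lean`) that every later stub
proof (S3c `stub_boxGaussianDomination`, S4 `stub_boxKernelVsLattice`) uses:

* `boxCirc_eq_dotProduct` / `boxCirc_eq_sum` — the circulation is LINEAR in the free variables, `s(p) = λ_p · s`
  (`LatticeMaxwell.coeff`, the pinned values being `0`);
* `isGaussianProcess_boxCirc` — `p ↦ s(p)` is a centred (`integral_boxCirc`) Gaussian process under `boxMaxwell H`
  (Mathlib `IsGaussianProcess`, via `of_isGaussianProcess` from the coordinate process);
* `integral_boxCirc_mul_boxCirc` — its two-point function is the bilinear form of the inverse precision matrix,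
  `E_τ[s(p)s(q)] = λ_p · Q⁻¹ λ_q` (`Q = LatticeMaxwell.Qmat IsComb 0 (2H+1)`, positive definite by Chatterjee's
  Lemma 13.1, tree `LatticeMaxwell.posDef_Qmat`), whence `boxMaxwellPlaqCov_eq_dotProduct`:
  **D1 is the matrix element `λ_{p_c} · Q⁻¹ λ_{p_c + T e₀}`**;
* `integral_boxCirc_sq_mul_sq_sub` — Wick for any two plaquettes (tree `GaussianWick.integral_prod_four`).

References: L. Isserlis, Biometrika 12 (1918); S. Janson, *Gaussian Hilbert Spaces* (1997) Thm 1.28 (tree file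
`Literature/Probability/Distributions/GaussianWickTheorem.lean`); S. Chatterjee, arXiv:1602.01222 §13 (tree file
`Literature/MathematicalPhysics/QuantumFieldTheory/LatticeMaxwellGaussian.lean`).  No definition, no named fact, no
sorry; standard axioms.  NOT a claim about the mass gap: a Gaussian identity.
-/

set_option autoImplicit false

noncomputable section

open MeasureTheory ProbabilityTheory Matrix
open Literature.MathematicalPhysics.QuantumFieldTheory
open Literature.MathematicalPhysics.QuantumFieldTheory.LatticeMaxwell
open Literature.MathematicalPhysics.QuantumFieldTheory.AxialGauge

namespace Summit.QuantumFields.YangMills.Theorems.WeakCouplingRates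

variable {H : ℕ}

/-! ## The Gaussian `boxMaxwell H` and the linear structure of the circulations -/

/-- The comb tree of the untranslated box is pinned by `IsComb` (hypothesis `hpin` of
`LatticeMaxwell.posDef_Qmat` for the corner `a = 0`). -/
theorem isComb_shiftE_zero (n : ℕ) :
    ∀ e ∈ boxEdges 4 n, IsComb e →
      IsComb (shiftE (0 : Literature.Probability.LatticeModels.Site 4) e) := by
  intro e _ he
  simpa using he

/-- The precision matrix `Q` of the comb-gauge box form `Σ_{p ⊆ box} s(p)²` is positive definite (Chatterjee's
Lemma 13.1, tree `LatticeMaxwell.posDef_Qmat`). -/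
theorem posDef_boxQmat (H : ℕ) :
    (Qmat (AxialGauge.IsComb (d := 4)) (0 : Literature.Probability.LatticeModels.Site 4)
      (2 * H + 1)).PosDef :=
  posDef_Qmat (isComb_shiftE_zero (2 * H + 1))

/-- The covariance matrix `Q⁻¹` of `boxMaxwell H = N(0, Q⁻¹)` is positive semidefinite. -/
theorem posSemidef_boxQmat_inv (H : ℕ) :
    (Qmat (AxialGauge.IsComb (d := 4)) (0 : Literature.Probability.LatticeModels.Site 4)
      (2 * H + 1))⁻¹.PosSemidef :=
  (posDef_boxQmat H).inv.posSemidef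

/-- **The circulation is linear in the free variables** (the pinned values being `0`):
`boxCirc H p s = λ_p · s` with `λ_p = LatticeMaxwell.coeff IsComb 0 (2H+1) p`. -/
theorem boxCirc_eq_dotProduct (p : Plaq 4) (s : EuclideanSpace ℝ (BoxFree H)) :
    boxCirc H p s = coeff IsComb (0 : Literature.Probability.LatticeModels.Site 4) (2 * H + 1) p ⬝ᵥ
      WithLp.ofLp s := by
  rw [boxCirc, sCirc_glue, bterm]
  have : sCirc (glue (pin := IsComb) (0 : Literature.Probability.LatticeModels.Site 4) (2 * H + 1)
      (0 : ZdEdge 4 → ℝ) (0 : BoxFree H → ℝ)) p = 0 := by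
    simp [sCirc, glue_zero_eq_sum]
  rw [this, add_zero]

/-- `boxCirc H p s = Σ_e λ_p(e) · s_e`. -/
theorem boxCirc_eq_sum (p : Plaq 4) (s : EuclideanSpace ℝ (BoxFree H)) :
    boxCirc H p s = ∑ e : BoxFree H,
      coeff IsComb (0 : Literature.Probability.LatticeModels.Site 4) (2 * H + 1) p e * s e := by
  rw [boxCirc_eq_dotProduct]; rfl

/-- The coordinate process of `boxMaxwell H` is a Gaussian process (it is a multivariate Gaussian). -/
theorem isGaussianProcess_eval_boxMaxwell (H : ℕ) :
    IsGaussianProcess (fun (e : BoxFree H) (s : EuclideanSpace ℝ (BoxFree H)) => s e)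
      (boxMaxwell H) :=
  Literature.Probability.LatticeModels.isGaussianProcess_eval_multivariateGaussian _ _

/-- **The circulation process `p ↦ s(p)` is a Gaussian process** under `boxMaxwell H` (a finite linear
image of the coordinate process). -/
theorem isGaussianProcess_boxCirc (H : ℕ) : IsGaussianProcess (boxCirc H) (boxMaxwell H) := by
  classical
  refine (isGaussianProcess_eval_boxMaxwell H).of_isGaussianProcess fun p => ?_
  refine ⟨Finset.univ, ∑ e : BoxFree H,
    coeff IsComb (0 : Literature.Probability.LatticeModels.Site 4) (2 * H + 1) p e •
      ContinuousLinearMap.proj (R := ℝ) (φ := fun _ : ↥(Finset.univ : Finset (BoxFree H)) => ℝ)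
        ⟨e, Finset.mem_univ e⟩, fun s => ?_⟩
  rw [boxCirc_eq_sum]
  simp [Finset.restrict_def]

/-- Coordinates are integrable under `boxMaxwell H`. -/
theorem integrable_eval_boxMaxwell (e : BoxFree H) :
    Integrable (fun s : EuclideanSpace ℝ (BoxFree H) => s e) (boxMaxwell H) :=
  ((isGaussianProcess_eval_boxMaxwell H).hasGaussianLaw_eval e).memLp_two.integrable one_le_two

/-- Products of two coordinates are integrable under `boxMaxwell H`. -/
theorem integrable_eval_mul_eval_boxMaxwell (e f : BoxFree H) :
    Integrable (fun s : EuclideanSpace ℝ (BoxFree H) => s e * s f) (boxMaxwell H) :=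
  ((isGaussianProcess_eval_boxMaxwell H).hasGaussianLaw_eval e).memLp_two.integrable_mul
    ((isGaussianProcess_eval_boxMaxwell H).hasGaussianLaw_eval f).memLp_two

/-- **The circulations are centred**: `E_τ[s(p)] = 0`. -/
theorem integral_boxCirc (p : Plaq 4) : ∫ s, boxCirc H p s ∂(boxMaxwell H) = 0 := by
  simp_rw [boxCirc_eq_sum]
  rw [integral_finsetSum _ fun e _ => (integrable_eval_boxMaxwell e).const_mul _]
  refine Finset.sum_eq_zero fun e _ => ?_
  rw [integral_const_mul]
  erw [Literature.Probability.Distributions.GaussianWick.integral_eval_multivariateGaussian_zero]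
  rw [mul_zero]

/-- **The two-point function of the circulations is the bilinear form of `Q⁻¹`**:
`E_τ[s(p) s(q)] = λ_p · Q⁻¹ λ_q`. -/
theorem integral_boxCirc_mul_boxCirc (p q : Plaq 4) :
    ∫ s, boxCirc H p s * boxCirc H q s ∂(boxMaxwell H) =
      coeff IsComb (0 : Literature.Probability.LatticeModels.Site 4) (2 * H + 1) p ⬝ᵥ
        (Qmat (AxialGauge.IsComb (d := 4)) (0 : Literature.Probability.LatticeModels.Site 4)
          (2 * H + 1))⁻¹ *ᵥ
        coeff IsComb (0 : Literature.Probability.LatticeModels.Site 4) (2 * H + 1) q := by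
  classical
  set cp := coeff IsComb (0 : Literature.Probability.LatticeModels.Site 4) (2 * H + 1) p with hcp
  set cq := coeff IsComb (0 : Literature.Probability.LatticeModels.Site 4) (2 * H + 1) q with hcq
  set S := (Qmat (AxialGauge.IsComb (d := 4)) (0 : Literature.Probability.LatticeModels.Site 4)
          (2 * H + 1))⁻¹ with hS
  have hint : ∀ s : EuclideanSpace ℝ (BoxFree H), boxCirc H p s * boxCirc H q s =
      ∑ e, ∑ f, cp e * cq f * (s e * s f) := fun s => by
    rw [boxCirc_eq_sum, boxCirc_eq_sum, Finset.sum_mul_sum]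
    refine Finset.sum_congr rfl fun e _ => Finset.sum_congr rfl fun f _ => ?_
    ring
  simp_rw [hint]
  rw [integral_finsetSum _ fun e _ => integrable_finsetSum _ fun f _ =>
    (integrable_eval_mul_eval_boxMaxwell e f).const_mul _]
  simp_rw [integral_finsetSum _ fun f _ => (integrable_eval_mul_eval_boxMaxwell _ f).const_mul _,
    integral_const_mul]
  have h2 : ∀ e f : BoxFree H, ∫ s : EuclideanSpace ℝ (BoxFree H), s e * s f ∂(boxMaxwell H) =
      S e f := fun e f =>
    Literature.Probability.Distributions.GaussianWick.integral_eval_mul_eval_multivariateGaussian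
      (posSemidef_boxQmat_inv H) e f
  simp_rw [h2]
  simp only [dotProduct, mulVec, Finset.mul_sum]
  refine Finset.sum_congr rfl fun e _ => Finset.sum_congr rfl fun f _ => ?_
  ring

/-- **D1 is a matrix element of the inverse precision matrix**:
`boxMaxwellPlaqCov H T = λ_{p_c} · Q⁻¹ λ_{p_c + T e₀}`. -/
theorem boxMaxwellPlaqCov_eq_dotProduct (H T : ℕ) :
    boxMaxwellPlaqCov H T =
      coeff IsComb (0 : Literature.Probability.LatticeModels.Site 4) (2 * H + 1)
          (plaq12At (boxCentre H)) ⬝ᵥ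
        (Qmat (AxialGauge.IsComb (d := 4)) (0 : Literature.Probability.LatticeModels.Site 4)
          (2 * H + 1))⁻¹ *ᵥ
        coeff IsComb (0 : Literature.Probability.LatticeModels.Site 4) (2 * H + 1)
          (plaq12At (boxCentre H + Pi.single 0 (T : ℤ))) := by
  rw [boxMaxwellPlaqCov_eq_integral_boxCirc, integral_boxCirc_mul_boxCirc]

/-! ## Wick's theorem for the squared circulations -/

/-- **Wick / Isserlis for the squared circulations**: for every two plaquettes `p, q`,
`E_τ[s(p)²s(q)²] − E_τ[s(p)²]E_τ[s(q)²] = 2 · E_τ[s(p)s(q)]²` (the four-point function is the sum over the three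
pairings; the pairing `(pp)(qq)` cancels against the product of second moments). -/
theorem integral_boxCirc_sq_mul_sq_sub (p q : Plaq 4) :
    (∫ s, boxCirc H p s ^ 2 * boxCirc H q s ^ 2 ∂(boxMaxwell H)) -
        (∫ s, boxCirc H p s ^ 2 ∂(boxMaxwell H)) * (∫ s, boxCirc H q s ^ 2 ∂(boxMaxwell H)) =
      2 * (∫ s, boxCirc H p s * boxCirc H q s ∂(boxMaxwell H)) ^ 2 := by
  have h4 := Literature.Probability.Distributions.GaussianWick.integral_prod_four
    (isGaussianProcess_boxCirc H) integral_boxCirc ![p, p, q, q]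
  simp only [Matrix.cons_val_zero, Matrix.cons_val_one] at h4
  have e2 : (![p, p, q, q] : Fin 4 → Plaq 4) 2 = q := rfl
  have e3 : (![p, p, q, q] : Fin 4 → Plaq 4) 3 = q := rfl
  rw [e2, e3] at h4
  have hl : ∀ s, boxCirc H p s ^ 2 * boxCirc H q s ^ 2 =
      boxCirc H p s * boxCirc H p s * boxCirc H q s * boxCirc H q s := fun s => by ring
  have hp2 : ∀ s, boxCirc H p s ^ 2 = boxCirc H p s * boxCirc H p s := fun s => by ring
  have hq2 : ∀ s, boxCirc H q s ^ 2 = boxCirc H q s * boxCirc H q s := fun s => by ring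
  simp_rw [hl, hp2, hq2, h4]
  ring

/-- **Stub S3a `stub_boxGaussianWick` (registered signature, verbatim)**: for all `H, T`, the connected two-point
function of the squared circulations of the two plaquettes of D1 is `2 · boxMaxwellPlaqCov H T ²`. -/
theorem stub_boxGaussianWick : ∀ H T : ℕ, boxCircSqCov H T = 2 * boxMaxwellPlaqCov H T ^ 2 := by
  intro H T
  rw [boxCircSqCov, integral_boxCirc_sq_mul_sq_sub, boxMaxwellPlaqCov_eq_integral_boxCirc]

/-- In particular the Gaussian surrogate covariance is nonnegative: `0 ≤ boxCircSqCov H T`. -/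
theorem boxCircSqCov_nonneg (H T : ℕ) : 0 ≤ boxCircSqCov H T := by
  rw [stub_boxGaussianWick]; positivity

end Summit.QuantumFields.YangMills.Theorems.WeakCouplingRates

end
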